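import Mathlib
import Summits.NavierStokesRegularity.NavierStokesRegularity.Theorems.SymmetryModuliCountFarPastLedgerSliceRateTools
import HarnessLib

/-!
# Slice pressure, the large-scale average bound (crux `FarPastLedger`, line `uloc-gronwall-transplant`)

Helper file for the lead's stub `stub_fplSlicePressure` of crux stmt-NavierStokesRegularity-14060
(`SymmetryModuliCount.FarPastLedger`). Abstract form of the rate estimate: if on `B(0, 2r)`

  `Dq(x) - DN(x) + G(x) = A`,  `‖G(x)‖ ≤ B_G`,  `∫ N² ≤ S`,

with `N ∈ C^∞ ∩ L²`, then the bump average of `∇q` at scale `r` recovers the vector `a = A♯` up to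
`(r³ ∫θ)⁻¹ √(r C_θ) √S + B_G`, `C_θ = ∫ ‖Dθ‖²` (`fpl_rate_core`): integrate `θ_r ∇q`, move `D` from
`N` onto `θ_r` (integration by parts, Cauchy–Schwarz, `‖∂ₑθ_r‖₂² ≤ r ‖e‖² C_θ`) and bound the
`G`-term pointwise.
-/

noncomputable section

open MeasureTheory Set Filter Metric Topology InnerProductSpace
open scoped ContDiff

set_option linter.dupNamespace false -- nested layout Summit.<S>.<Sub>, Sub = S (D-0017)

namespace Summit.NavierStokesRegularity.NavierStokesRegularity.Theorems

/-- The scaled weight `θ(x/r)` vanishes off `B(0, 2r)` when `θ` vanishes off `B(0, 2)`, `r > 0`. -/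
theorem fpl_scaled_eq_zero {θ : EuclideanSpace ℝ (Fin 3) → ℝ}
    (hθsupp : ∀ x ∉ ball (0 : EuclideanSpace ℝ (Fin 3)) 2, θ x = 0) {r : ℝ} (hr : 0 < r)
    {x : EuclideanSpace ℝ (Fin 3)} (hx : x ∉ ball (0 : EuclideanSpace ℝ (Fin 3)) (2 * r)) :
    θ (r⁻¹ • x) = 0 := by
  refine hθsupp _ fun h => hx ?_
  rw [mem_ball, dist_zero_right, norm_smul, norm_inv, Real.norm_of_nonneg hr.le] at h
  rw [mem_ball, dist_zero_right]
  rw [inv_mul_lt_iff₀ hr] at h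
  linarith

set_option maxHeartbeats 400000 in -- large assembly proof; insurance against farm variance
/-- **THE RATE ESTIMATE (abstract core).** See the module docstring. -/
theorem fpl_rate_core {θ : EuclideanSpace ℝ (Fin 3) → ℝ} (hθd : ContDiff ℝ ∞ θ)
    (hθ0 : ∀ x, 0 ≤ θ x) (hθsupp : ∀ x ∉ ball (0 : EuclideanSpace ℝ (Fin 3)) 2, θ x = 0)
    (hm : 0 < ∫ x, θ x)
    {q : EuclideanSpace ℝ (Fin 3) → ℝ} (hq : ContDiff ℝ ∞ q) {N : EuclideanSpace ℝ (Fin 3) → ℝ}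
    (hN : ContDiff ℝ ∞ N) (hNm : MemLp N 2 volume)
    {G : EuclideanSpace ℝ (Fin 3) → EuclideanSpace ℝ (Fin 3) →L[ℝ] ℝ}
    {A : EuclideanSpace ℝ (Fin 3) →L[ℝ] ℝ} {r : ℝ} (hr : 1 ≤ r)
    (hident : ∀ x ∈ ball (0 : EuclideanSpace ℝ (Fin 3)) (2 * r), fderiv ℝ q x - fderiv ℝ N x + G x = A)
    {B_G : ℝ} (hG : ∀ x ∈ ball (0 : EuclideanSpace ℝ (Fin 3)) (2 * r), ‖G x‖ ≤ B_G)
    {S : ℝ} (hNsq : ∫ x, N x ^ 2 ≤ S) :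
    ‖(∫ x, θ (r⁻¹ • x))⁻¹ • (∫ x, θ (r⁻¹ • x) • gradient q x) - (toDual ℝ (EuclideanSpace ℝ (Fin 3))).symm A‖ ≤
      (r ^ 3 * ∫ x, θ x)⁻¹ * (Real.sqrt (r * ∫ z, ‖fderiv ℝ θ z‖ ^ 2) * Real.sqrt S) + B_G := by
  have hr0 : 0 < r := by linarith
  set θr : EuclideanSpace ℝ (Fin 3) → ℝ := fun x => θ (r⁻¹ • x) with hθr
  set a : EuclideanSpace ℝ (Fin 3) := (toDual ℝ (EuclideanSpace ℝ (Fin 3))).symm A with ha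
  -- properties of the scaled weight
  have hθc : HasCompactSupport θ := by
    refine HasCompactSupport.intro (isCompact_closedBall (0 : EuclideanSpace ℝ (Fin 3)) 2) fun x hx => hθsupp x ?_
    exact fun h => hx (ball_subset_closedBall h)
  have hθrd : ContDiff ℝ ∞ θr := hθd.comp (contDiff_id.const_smul _)
  have hθr0 : ∀ x, 0 ≤ θr x := fun x => hθ0 _
  have hθrz : ∀ x ∉ ball (0 : EuclideanSpace ℝ (Fin 3)) (2 * r), θr x = 0 := fun x hx => fpl_scaled_eq_zero hθsupp hr0 hx
  have hθrc : HasCompactSupport θr := by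
    refine HasCompactSupport.intro (isCompact_closedBall (0 : EuclideanSpace ℝ (Fin 3)) (2 * r)) fun x hx => hθrz x ?_
    exact fun h => hx (ball_subset_closedBall h)
  have hθrcont : Continuous θr := hθrd.continuous
  have hθri : Integrable θr volume := hθrcont.integrable_of_hasCompactSupport hθrc
  -- the mass `m = ∫ θr = r³ ∫ θ > 0`
  have hmass : ∫ x, θr x = r ^ 3 * ∫ x, θ x := by
    rw [hθr]
    rw [Measure.integral_comp_inv_smul_of_nonneg volume θ hr0.le, finrank_euclideanSpace_fin, smul_eq_mul]
  have hm_pos : 0 < ∫ x, θr x := by rw [hmass]; exact mul_pos (pow_pos hr0 3) hm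
  -- continuity of `Dq`, `DN`, integrability of the pieces
  have hDq : Continuous (fderiv ℝ q) := hq.continuous_fderiv (by simp)
  have hDN : Continuous (fderiv ℝ N) := hN.continuous_fderiv (by simp)
  have hgradq : Continuous (gradient q) := (toDual ℝ (EuclideanSpace ℝ (Fin 3))).symm.continuous.comp hDq
  have hI1 : Integrable (fun x => θr x • gradient q x) volume :=
    (hθrcont.smul hgradq).integrable_of_hasCompactSupport hθrc.smul_right
  have hI2 : Integrable (fun x => θr x • a) volume := hθri.smul_const a
  have hI3 : Integrable (fun x => θr x • (fderiv ℝ q x - A)) volume :=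
    (hθrcont.smul (hDq.sub continuous_const)).integrable_of_hasCompactSupport hθrc.smul_right
  have hI4 : Integrable (fun x => θr x • fderiv ℝ N x) volume :=
    (hθrcont.smul hDN).integrable_of_hasCompactSupport hθrc.smul_right
  -- decomposition of the average: `∫ θr ∇q = m • a + ♯(∫ θr (Dq - A))`
  have hdec : ∫ x, θr x • gradient q x =
      (∫ x, θr x) • a + (toDual ℝ (EuclideanSpace ℝ (Fin 3))).symm (∫ x, θr x • (fderiv ℝ q x - A)) := by
    have hpt : ∀ x, θr x • gradient q x = θr x • a + (toDual ℝ (EuclideanSpace ℝ (Fin 3))).symm (θr x • (fderiv ℝ q x - A)) := by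
      intro x
      rw [LinearIsometryEquiv.map_smul, ← smul_add, ha, ← LinearIsometryEquiv.map_add, add_sub_cancel]
      rfl
    have hcomm : ∫ x, (toDual ℝ (EuclideanSpace ℝ (Fin 3))).symm (θr x • (fderiv ℝ q x - A)) =
        (toDual ℝ (EuclideanSpace ℝ (Fin 3))).symm (∫ x, θr x • (fderiv ℝ q x - A)) :=
      (toDual ℝ (EuclideanSpace ℝ (Fin 3))).symm.toLinearIsometry.integral_comp_comm _
    have hI3' : Integrable (fun x => (toDual ℝ (EuclideanSpace ℝ (Fin 3))).symm (θr x • (fderiv ℝ q x - A)))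
        volume :=
      (toDual ℝ (EuclideanSpace ℝ (Fin 3))).symm.toLinearIsometry.toContinuousLinearMap.integrable_comp hI3
    rw [integral_congr_ae (Eventually.of_forall hpt), integral_add hI2 hI3', integral_smul_const, hcomm]
  -- the remainder
  have hrem : (∫ x, θr x)⁻¹ • (∫ x, θr x • gradient q x) - a =
      (∫ x, θr x)⁻¹ • (toDual ℝ (EuclideanSpace ℝ (Fin 3))).symm (∫ x, θr x • (fderiv ℝ q x - A)) := by
    rw [hdec, smul_add, smul_smul, inv_mul_cancel₀ hm_pos.ne', one_smul, add_sub_cancel_left]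
  rw [show (fun x => θ (r⁻¹ • x)) = θr from rfl] at *
  rw [hrem, norm_smul, norm_inv, Real.norm_of_nonneg hm_pos.le, LinearIsometryEquiv.norm_map]
  -- `∫ θr (Dq - A) = ∫ θr DN - ∫ θr G`
  have hptK : ∀ x, θr x • (fderiv ℝ q x - A) = θr x • fderiv ℝ N x - θr x • G x := by
    intro x
    by_cases hx : x ∈ ball (0 : EuclideanSpace ℝ (Fin 3)) (2 * r)
    · rw [← smul_sub]
      congr 1
      have := hident x hx
      rw [← this]; abel
    · rw [hθrz x hx, zero_smul, zero_smul, zero_smul, sub_zero]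
  have hI5 : Integrable (fun x => θr x • G x) volume := by
    have : (fun x => θr x • G x) = fun x => θr x • fderiv ℝ N x - θr x • (fderiv ℝ q x - A) := by
      funext x; rw [hptK x]; abel
    rw [this]
    exact hI4.sub hI3
  have hK : ∫ x, θr x • (fderiv ℝ q x - A) = (∫ x, θr x • fderiv ℝ N x) - ∫ x, θr x • G x := by
    rw [integral_congr_ae (Eventually.of_forall hptK), integral_sub hI4 hI5]
  rw [hK]
  -- the `G`-term
  have hGterm : ‖∫ x, θr x • G x‖ ≤ (∫ x, θr x) * B_G := by
    calc ‖∫ x, θr x • G x‖ ≤ ∫ x, ‖θr x • G x‖ := norm_integral_le_integral_norm _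
      _ ≤ ∫ x, θr x * B_G := by
          refine integral_mono_of_nonneg (Eventually.of_forall fun x => norm_nonneg _)
            (hθri.mul_const B_G) (Eventually.of_forall fun x => ?_)
          show ‖θr x • G x‖ ≤ θr x * B_G
          by_cases hx : x ∈ ball (0 : EuclideanSpace ℝ (Fin 3)) (2 * r)
          · rw [norm_smul, Real.norm_of_nonneg (hθr0 x)]
            exact mul_le_mul_of_nonneg_left (hG x hx) (hθr0 x)
          · rw [hθrz x hx, zero_smul, norm_zero, zero_mul]
      _ = (∫ x, θr x) * B_G := integral_mul_const _ _
  -- the `N`-term: integration by parts and Cauchy–Schwarz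
  set Cθ : ℝ := ∫ z, ‖fderiv ℝ θ z‖ ^ 2 with hCθ
  have hCθ0 : 0 ≤ Cθ := integral_nonneg fun z => by positivity
  have hS0 : 0 ≤ S := le_trans (integral_nonneg fun x => sq_nonneg _) hNsq
  have hNterm : ‖∫ x, θr x • fderiv ℝ N x‖ ≤ Real.sqrt (r * Cθ) * Real.sqrt S := by
    refine ContinuousLinearMap.opNorm_le_bound _ (by positivity) fun e => ?_
    rw [ContinuousLinearMap.integral_apply hI4 e]
    simp only [FunLike.coe_smul, Pi.smul_apply, smul_eq_mul]
    -- integration by parts: `∫ θr ∂ₑN = -∫ ∂ₑθr N`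
    have hθr1 : ContDiff ℝ 1 θr := hθrd.of_le (by norm_cast)
    have hDθr : Continuous (fderiv ℝ θr) := hθr1.continuous_fderiv one_ne_zero
    have hDθrc : HasCompactSupport (fderiv ℝ θr) := hθrc.fderiv (𝕜 := ℝ)
    have hDθrce : HasCompactSupport (fun x => fderiv ℝ θr x e) := hθrc.fderiv_apply (𝕜 := ℝ) e
    have hi1 : Integrable (fun x => fderiv ℝ θr x e * N x) volume :=
      ((hDθr.clm_apply continuous_const).mul hN.continuous).integrable_of_hasCompactSupport
        hDθrce.mul_right
    have hi2 : Integrable (fun x => θr x * fderiv ℝ N x e) volume :=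
      (hθrcont.mul (hDN.clm_apply continuous_const)).integrable_of_hasCompactSupport hθrc.mul_right
    have hi3 : Integrable (fun x => θr x * N x) volume :=
      (hθrcont.mul hN.continuous).integrable_of_hasCompactSupport hθrc.mul_right
    have hibp := integral_mul_fderiv_eq_neg_fderiv_mul_of_integrable hi1 hi2 hi3
      (fun x _ => (hθrd.differentiable (by simp)) x) (fun x _ => (hN.differentiable (by simp)) x)
    rw [hibp, norm_neg, Real.norm_eq_abs]
    -- Cauchy–Schwarz
    have hF : MemLp (fun x => fderiv ℝ θr x e) 2 volume :=
      (hDθr.clm_apply continuous_const).memLp_of_hasCompactSupport hDθrce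
    have hcs := fpl_abs_integral_mul_le_sqrt hF hNm
    refine hcs.trans ?_
    have h1 : Real.sqrt (∫ x, (fderiv ℝ θr x e) ^ 2) ≤ Real.sqrt (r * Cθ) * ‖e‖ := by
      have := fpl_integral_sq_fderiv_scaled_le (θ := θ) (hθd.of_le (by norm_cast)) hθc hr0 e
      calc Real.sqrt (∫ x, (fderiv ℝ θr x e) ^ 2) ≤ Real.sqrt (r * ‖e‖ ^ 2 * Cθ) := Real.sqrt_le_sqrt this
        _ = Real.sqrt (r * Cθ) * ‖e‖ := by
            rw [show r * ‖e‖ ^ 2 * Cθ = (r * Cθ) * ‖e‖ ^ 2 by ring, Real.sqrt_mul (by positivity),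
              Real.sqrt_sq (norm_nonneg _)]
    have h2 : Real.sqrt (∫ x, N x ^ 2) ≤ Real.sqrt S := Real.sqrt_le_sqrt hNsq
    calc Real.sqrt (∫ x, (fderiv ℝ θr x e) ^ 2) * Real.sqrt (∫ x, N x ^ 2)
        ≤ (Real.sqrt (r * Cθ) * ‖e‖) * Real.sqrt S :=
          mul_le_mul h1 h2 (Real.sqrt_nonneg _) (by positivity)
      _ = Real.sqrt (r * Cθ) * Real.sqrt S * ‖e‖ := by ring
  -- assemble
  calc (∫ x, θr x)⁻¹ * ‖(∫ x, θr x • fderiv ℝ N x) - ∫ x, θr x • G x‖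
      ≤ (∫ x, θr x)⁻¹ * (Real.sqrt (r * Cθ) * Real.sqrt S + (∫ x, θr x) * B_G) := by
        refine mul_le_mul_of_nonneg_left ((norm_sub_le _ _).trans (add_le_add hNterm hGterm)) ?_
        exact inv_nonneg.2 hm_pos.le
    _ = (r ^ 3 * ∫ x, θ x)⁻¹ * (Real.sqrt (r * Cθ) * Real.sqrt S) + B_G := by
        rw [mul_add, show (∫ x, θr x)⁻¹ * ((∫ x, θr x) * B_G) = B_G by
          rw [← mul_assoc, inv_mul_cancel₀ hm_pos.ne', one_mul], hmass]

/-- Registered form (sub-goal `fpl_sliceRate_main` of crux stmt-NavierStokesRegularity-14060): the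
abstract rate estimate. -/
theorem fpl_sliceRate_main :
    ∀ (θ : EuclideanSpace ℝ (Fin 3) → ℝ), ContDiff ℝ (⊤ : ℕ∞) θ → (∀ x, 0 ≤ θ x) →
    (∀ x ∉ Metric.ball (0 : EuclideanSpace ℝ (Fin 3)) 2, θ x = 0) → (0 < ∫ x, θ x) →
    ∀ (q : EuclideanSpace ℝ (Fin 3) → ℝ), ContDiff ℝ (⊤ : ℕ∞) q →
    ∀ (N : EuclideanSpace ℝ (Fin 3) → ℝ), ContDiff ℝ (⊤ : ℕ∞) N →
    MeasureTheory.MemLp N 2 MeasureTheory.volume →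
    ∀ (G : EuclideanSpace ℝ (Fin 3) → EuclideanSpace ℝ (Fin 3) →L[ℝ] ℝ)
      (A : EuclideanSpace ℝ (Fin 3) →L[ℝ] ℝ) (r : ℝ), 1 ≤ r →
    (∀ x ∈ Metric.ball (0 : EuclideanSpace ℝ (Fin 3)) (2 * r), fderiv ℝ q x - fderiv ℝ N x + G x = A) →
    ∀ (B_G : ℝ), (∀ x ∈ Metric.ball (0 : EuclideanSpace ℝ (Fin 3)) (2 * r), ‖G x‖ ≤ B_G) →
    ∀ (S : ℝ), (∫ x, N x ^ 2 ≤ S) →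
    ‖(∫ x, θ (r⁻¹ • x))⁻¹ • (∫ x, θ (r⁻¹ • x) • gradient q x) -
        (InnerProductSpace.toDual ℝ (EuclideanSpace ℝ (Fin 3))).symm A‖ ≤
      (r ^ 3 * ∫ x, θ x)⁻¹ * (Real.sqrt (r * ∫ z, ‖fderiv ℝ θ z‖ ^ 2) * Real.sqrt S) + B_G :=
  fun _ hθd hθ0 hθsupp hm _ hq _ hN hNm _ _ _ hr hident _ hG _ hNsq =>
    fpl_rate_core hθd hθ0 hθsupp hm hq hN hNm hr hident hG hNsq

end Summit.NavierStokesRegularity.NavierStokesRegularity.Theorems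

end
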